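import Mathlib
import Literature.Computability.AlgebraicComplexity.NestFreeMatchingPoly
import Literature.Computability.AlgebraicComplexity.ArithCircuitProofs
import Summits.ValiantsHypothesis.ValiantsHypothesis.Theorems.FifoMatchingNNDivisionHardAdjacentArcFace
import HarnessLib

/-!
# Route FifoMatching — crux `NNDivisionHard` (stmt-ValiantsHypothesis-21181): REVERSAL SYMMETRY of the nest-free matching
# polynomial and the mirrored unique-maximiser rung

The order reversal `i ↦ 2n−1−i` of `[0, 2n)` maps nestings to nestings, hence nest-free perfect matchings to nest-free
perfect matchings (`M ↦ rev ∘ M ∘ rev`), and arcs `(i, j)` to arcs `(rev j, rev i)`: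

* `conj_mem_perfectMatchings`, `conj_mem_nestFreeMatchings`, `arcMonomial_conj` — bookkeeping of the conjugation;
* ★ `rename_rev_nestFreeMatchingPoly` — **`NN_n` is invariant under the arc reversal `ρ(i, j) = (rev j, rev i)`**;
  `rev_injective'`, `complexity_rename_rev` — `ρ` is injective, so `L₊` is `ρ`-invariant;
* ★★ `complexity_nn_le_of_unique_max_rev` — the MIRROR of `AdjacentArcFace.complexity_nn_le_of_unique_max'`: for the
  adjacent arc `e = (2c, 2c+1)` of `[0, 2n)`, if one monomial of `h` has strictly larger `x_e`-degree than all others,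
  then the SUFFIX side is exposed: `L₊(NN_{n−1−c}) ≤ 16((2(n−1−c)+1)(L₊(NN_n · h)+3))²`.

With the prefix-side rung (`L₊(NN_c) ≤ …`) every adjacent arc exposes a block of half-length `≥ (n−1)/2`, so a cofactor
with a unique maximiser of SOME adjacent-arc degree is never a quasi-polynomial certificate (crux currency in
`…NNDivisionHardAdjacentArcTier`).  HONEST FRAMING: symmetry bookkeeping and a rung; stmt-21181 stays OPEN; nothing here
bears on `NNNotVP` or on VP ≠ VNP (NOT proved).
References: Chen–Deng–Du–Stanley–Yan 2007 §1 [ChenDengDuStanleyYan2007]; Bürgisser 2000 Rem. 2.2 [Burgisser2000];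
Jukna–Seiwert–Sergeev 2022 Thm 1 [JuknaSeiwertSergeev2022].
-/

noncomputable section

-- Sub = Summit single-conjunct layout: the duplicated namespace component is mandated by the tree.
set_option linter.dupNamespace false
set_option autoImplicit false

namespace Summit.ValiantsHypothesis.ValiantsHypothesis.Theorems.FifoMatching.NNDivisionHard.Reversal

open Finset MvPolynomial Literature.Computability.AlgebraicComplexity
open Summit.ValiantsHypothesis.ValiantsHypothesis.Theorems.FifoMatching.NNDivisionHard.AdjacentArcFace
  (complexity_nn_le_of_unique_max')
open scoped NNReal BigOperators

variable {m : ℕ}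

/-! ### §1 Conjugation of matchings by the order reversal -/

/-- The conjugate `rev ∘ M ∘ rev` of a perfect matching is a perfect matching. [folklore] -/
theorem conj_mem_perfectMatchings {M : Fin m → Fin m} (hM : M ∈ perfectMatchings m) :
    (fun i => Fin.rev (M (Fin.rev i))) ∈ perfectMatchings m := by
  obtain ⟨hinv, hfp⟩ := mem_perfectMatchings.1 hM
  rw [mem_perfectMatchings]
  refine ⟨fun i => ?_, fun i h => ?_⟩
  · simp only [Fin.rev_rev, hinv]
  · have h' := congrArg Fin.rev h
    rw [Fin.rev_rev] at h'
    exact hfp (Fin.rev i) h'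

/-- **Reversal maps nestings to nestings**: the conjugate of a nest-free perfect matching is nest-free.
[cite: ChenDengDuStanleyYan2007, §1] -/
theorem conj_mem_nestFreeMatchings {M : Fin m → Fin m} (hM : M ∈ nestFreeMatchings m) :
    (fun i => Fin.rev (M (Fin.rev i))) ∈ nestFreeMatchings m := by
  obtain ⟨hPM, hnest⟩ := mem_nestFreeMatchings.1 hM
  obtain ⟨hinv, -⟩ := mem_perfectMatchings.1 hPM
  rw [mem_nestFreeMatchings]
  refine ⟨conj_mem_perfectMatchings hPM, fun i j hij hj hji => ?_⟩
  -- `i < j < rev (M (rev j)) < rev (M (rev i))`: with `a = rev j`, `b = rev i`: `M b < M a < a < b`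
  have h1 : M (Fin.rev j) < Fin.rev j := by rwa [Fin.lt_rev_iff] at hj
  have h2 : M (Fin.rev i) < M (Fin.rev j) := by rwa [Fin.rev_lt_rev] at hji
  have h3 : Fin.rev j < Fin.rev i := Fin.rev_lt_rev.2 hij
  refine hnest (M (Fin.rev i)) (M (Fin.rev j)) h2 ?_ ?_
  · rw [hinv]; exact h1
  · rw [hinv, hinv]; exact h3

/-- Conjugation is an involution. [folklore] -/
theorem conj_conj (M : Fin m → Fin m) : (fun i => Fin.rev ((fun i => Fin.rev (M (Fin.rev i))) (Fin.rev i))) = M := by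
  funext i; simp only [Fin.rev_rev]

/-- **The arc monomial of the conjugate is the reversed-renamed arc monomial**: `x^{rev∘M∘rev} = ρ(x^M)`,
`ρ(i, j) = (rev j, rev i)`. [folklore] -/
theorem arcMonomial_conj {k : Type*} [CommSemiring k] {M : Fin m → Fin m} (hM : M ∈ perfectMatchings m) :
    arcMonomial k (fun i => Fin.rev (M (Fin.rev i))) =
      rename (fun e : Fin m × Fin m => (Fin.rev e.2, Fin.rev e.1)) (arcMonomial k M) := by
  obtain ⟨hinv, -⟩ := mem_perfectMatchings.1 hM
  rw [arcMonomial_eq_prod_openers, arcMonomial_eq_prod_openers, map_prod]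
  simp only [rename_X]
  refine Finset.prod_nbij' (fun i => M (Fin.rev i)) (fun j => Fin.rev (M j)) ?_ ?_ ?_ ?_ ?_
  · intro i hi
    rw [mem_openers] at hi ⊢
    rw [hinv]
    change i < Fin.rev (M (Fin.rev i)) at hi
    rwa [Fin.lt_rev_iff] at hi
  · intro j hj
    rw [mem_openers] at hj ⊢
    rw [Fin.rev_rev, hinv, Fin.rev_lt_rev]
    exact hj
  · intro i _
    simp only [hinv, Fin.rev_rev]
  · intro j _
    simp only [Fin.rev_rev, hinv]
  · intro i _
    simp only [hinv, Fin.rev_rev]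

/-! ### §2 `NN_n` is reversal-invariant -/

variable {n : ℕ}

/-- The arc reversal `ρ(i, j) = (rev j, rev i)` is injective. [folklore] -/
theorem rev_injective' : Function.Injective (fun e : Fin (2 * n) × Fin (2 * n) => (Fin.rev e.2, Fin.rev e.1)) := by
  rintro ⟨i, j⟩ ⟨i', j'⟩ h
  simp only [Prod.mk.injEq, Fin.rev_inj] at h
  exact Prod.ext h.2 h.1

/-- ★ **REVERSAL INVARIANCE: `ρ(NN_n) = NN_n`.** [cite: ChenDengDuStanleyYan2007, §1] -/
theorem rename_rev_nestFreeMatchingPoly {k : Type*} [CommSemiring k] (n : ℕ) :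
    rename (fun e : Fin (2 * n) × Fin (2 * n) => (Fin.rev e.2, Fin.rev e.1)) (nestFreeMatchingPoly n k) =
      nestFreeMatchingPoly n k := by
  rw [nestFreeMatchingPoly_eq_sum_arcMonomial, map_sum]
  symm
  refine Finset.sum_nbij' (fun M => fun i => Fin.rev (M (Fin.rev i))) (fun M => fun i => Fin.rev (M (Fin.rev i)))
    ?_ ?_ ?_ ?_ ?_
  · intro M hM
    exact conj_mem_nestFreeMatchings hM
  · intro M hM
    exact conj_mem_nestFreeMatchings hM
  · intro M _; exact conj_conj M
  · intro M _; exact conj_conj M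
  · intro M hM
    have hc := conj_mem_nestFreeMatchings hM
    have e := arcMonomial_conj (k := k) (nestFreeMatchings_subset_perfectMatchings hc)
    rw [conj_conj] at e
    exact e

/-- `L₊` is invariant under the arc reversal. [cite: Burgisser2000, Rem. 2.2] -/
theorem complexity_rename_rev (q : MvPolynomial (Fin (2 * n) × Fin (2 * n)) ℝ≥0) :
    complexity (rename (fun e : Fin (2 * n) × Fin (2 * n) => (Fin.rev e.2, Fin.rev e.1)) q) = complexity q :=
  complexity_rename_of_injective_holds rev_injective' q

/-! ### §3 The mirrored unique-maximiser rung -/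

/-- ★★ **THE UNIQUE-MAXIMISER RUNG, SUFFIX SIDE.**  For the adjacent arc `e = (2c, 2c+1)` of `[0, 2n)` (`c + 1 ≤ n`): if one
monomial `m₀` of `h` has strictly larger `x_e`-degree than all other monomials of `h`, then
`L₊(NN_{n−1−c}) ≤ 16((2(n−1−c)+1)(L₊(NN_n · h)+3))²` (reverse, then `AdjacentArcFace.complexity_nn_le_of_unique_max'` at
`b = n−1−c`). [cite: JuknaSeiwertSergeev2022, Thm 1] -/
theorem complexity_nn_le_of_unique_max_rev {c : ℕ} (hc : c + 1 ≤ n)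
    {h : MvPolynomial (Fin (2 * n) × Fin (2 * n)) ℝ≥0} {m₀ : (Fin (2 * n) × Fin (2 * n)) →₀ ℕ} (hm₀ : m₀ ∈ h.support)
    (huniq : ∀ m ∈ h.support, m ≠ m₀ →
      m (⟨2 * c, by omega⟩, ⟨2 * c + 1, by omega⟩) < m₀ (⟨2 * c, by omega⟩, ⟨2 * c + 1, by omega⟩)) :
    complexity (nestFreeMatchingPoly (n - 1 - c) ℝ≥0) ≤
      16 * ((2 * (n - 1 - c) + 1) * (complexity (nestFreeMatchingPoly n ℝ≥0 * h) + 3)) ^ 2 := by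
  classical
  set ρ : Fin (2 * n) × Fin (2 * n) → Fin (2 * n) × Fin (2 * n) := fun e => (Fin.rev e.2, Fin.rev e.1) with hρ
  have hρinj : Function.Injective ρ := rev_injective'
  set b := n - 1 - c with hb
  have hbn : b + 1 ≤ n := by omega
  -- the reversed arc
  have hρe : ρ (⟨2 * c, by omega⟩, ⟨2 * c + 1, by omega⟩) = (⟨2 * b, by omega⟩, ⟨2 * b + 1, by omega⟩) := by
    refine Prod.ext (Fin.ext ?_) (Fin.ext ?_)
    · simp only [hρ, Fin.val_rev]; omega
    · simp only [hρ, Fin.val_rev]; omega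
  -- the reversed cofactor and its unique maximiser
  set h' := rename ρ h with hh'
  have hm₀' : Finsupp.mapDomain ρ m₀ ∈ h'.support := by
    rw [hh', support_rename_of_injective hρinj]
    exact Finset.mem_image_of_mem _ hm₀
  have huniq' : ∀ m ∈ h'.support, m ≠ Finsupp.mapDomain ρ m₀ →
      m (⟨2 * b, by omega⟩, ⟨2 * b + 1, by omega⟩) <
        Finsupp.mapDomain ρ m₀ (⟨2 * b, by omega⟩, ⟨2 * b + 1, by omega⟩) := by
    intro m hm hne
    rw [hh', support_rename_of_injective hρinj, Finset.mem_image] at hm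
    obtain ⟨m₁, hm₁, rfl⟩ := hm
    have hne₁ : m₁ ≠ m₀ := fun heq => hne (by rw [heq])
    rw [← hρe, Finsupp.mapDomain_apply hρinj, Finsupp.mapDomain_apply hρinj]
    exact huniq m₁ hm₁ hne₁
  have H := complexity_nn_le_of_unique_max' hbn hm₀' huniq'
  have hprod : nestFreeMatchingPoly n ℝ≥0 * h' = rename ρ (nestFreeMatchingPoly n ℝ≥0 * h) := by
    rw [map_mul, hh', hρ, rename_rev_nestFreeMatchingPoly]
  rw [hprod, complexity_rename_rev] at H
  exact H

end Summit.ValiantsHypothesis.ValiantsHypothesis.Theorems.FifoMatching.NNDivisionHard.Reversal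

end
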